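import Summits.QuantumFields.YangMills.Theorems.BalabanUVNodesPortS1LZdetReg

/-!
# NODE O port PT-A — THE GAUSSIAN HALF ON THE ε₀-CLASS AT FIXED CARRIERS, (P5) ROW IN THE SHAPE OF THE CARRIER-FREE CLASS LETTER `ClassP5NestReg` (★★★ director-ym №633 (a)–(c), ◆ C34;
# g11 part C, L-edition): ✓`lzdetResidueOnReg_of_carriers` re-run with the class letter's own form constant `γ′` (`PosDef ∧ form ≤ γ′`), untied from P0C's `(γ₀, γ₁)`

Cell `ym-nodeO-ideate`, porter seat PT-A-1 (gen 11); `--kind proof --supports stmt-QuantumFields-27930 --as helper`; count-neutral.  [I] = [Balaban1987RG1]; [16] = [Balaban1985UV3];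
[15] = [Balaban1985Variational].

WHY.  ★★★ №633 (a)–(b) rules the extra class letter CARRIER-FREE with its own constants `∃ ε₀ γ′` (✓`ClassP5NestReg`, ✓`…ClassRegDefs` §3); the first cut ✓`lzdetResidueOnReg_of_carriers`
typed the (P5)-class row with P0C's `(γ₀, γ₁)` (the `ClassP5Reg` shape).  This file re-runs the same proof with the row `PosDef ∧ ⟨v, T(B)v⟩ ≤ γ′|v|²` (the pointwise (63) identity
✓`phiLZdet_eq_sum_lzdetPiece_at` takes any positive form constant with `2γ′ ≤ R`; the lower bound was never used).
* ★★★ `lzdetResidueOnReg_of_carriers_classP5Nest`.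

HONEST FRAMING.  Class twin of landed bookkeeping; the class rows are HYPOTHESES (letters `ClassP2Reg`, `ClassP5NestReg` — asserted for nothing, inhabited nowhere); nothing of Bałaban's RG
estimates asserted, ported or discharged; ⟨27930⟩ OPEN 1∕4 · no claim; NODE O 0∕1; COUNT 8∕28 · K 1∕4 UNMOVED; finite `𝕋⁴_{L^K}` at fixed ε — NOT continuum ∕ OS; **the Yang–Mills mass gap
(Clay) is NOT proved by any of this.**  No `sorry`, no `def`, no `instance`; standard axioms.
-/

noncomputable section

open scoped BigOperators Matrix.Norms.L2Operator Topology Matrix Classical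
open Filter Finset

namespace Summit.QuantumFields.YangMills.Theorems.BalabanUVNodesPortS1

open Summit.QuantumFields.YangMills.Theorems.K0RecordFormatNames
open Literature.MathematicalPhysics.QuantumFieldTheory.Balaban1983to89
open Literature.MathematicalPhysics.QuantumFieldTheory.Balaban1983to89.Node00
open Literature.MathematicalPhysics.QuantumFieldTheory.Balaban1983to89.T4Continuum (T4Family)
open Literature.MathematicalPhysics.QuantumFieldTheory.Balaban1983to89.TreeLengthTorus
open Literature.MathematicalPhysics.QuantumFieldTheory.Balaban1983to89.B12TreeDecay (K₀ kappa₀ K₀_pos kappa₀_nonneg)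

variable (F : T4Family)

/-! ## §2  ★★★ The ε₀-class residue of `phiLZdet` at fixed carriers — `ClassP5NestReg`-shaped (P5) row (form constant `γ′` of the letter) -/

/-- ★★★ **THE GAUSSIAN SUB-HALF ON THE ε₀-CLASS AT FIXED CARRIERS, `ClassP5NestReg`-SHAPED (P5) ROW** (✓`lzdetResidueOnReg_of_carriers` with the (P5)-class row keyed to the class letter's OWN form
constant `γ′` — `PosDef ∧ ⟨v, T(B)v⟩ ≤ γ′|v|²`, no lower bound, no tie to P0C's `(γ₀, γ₁)`; radius condition `2γ′ ≤ R`).  As ✓`lzdetResidue_of_carriers` (same constants `κ₀(64,8) ≤ δ₀∕2 − 1`, `16c₀·(64K₀)·e^{δ₀} ≤ R`, same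
`E₁ = 2·13·4⁴·(R·Bc + 12(L·Mc)⁴)`, `κ = min κt (δ₀∕2) − 2`), WITHOUT the analyticity token, WITH: the class radius `0 < ε₀ ≤ 1∕(53581824·L⁶)`, `2ε₀ ≤ ε₁` (TokE radius), (g1) pointwise, and the three
class rows at `ε₀` DISPLAYED — (P2) at every class point, (P5) (`PosDef` + the `γ₁` form bound) at every class point, `CutsInUc … α₀ α₁` at every class point.  Conclusion:
`∃ Ψ Ew, Ψ.ResidueOnRegAtW F Mc k Ew a₀ ε₂₉ α₀ α₁ ε₀ E₁ κ (phiLZdet …)` — rows (a)–(e) and the (63) identity AT EVERY POINT of `InRegClass … ε₀`.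
[cite: Balaban1985UV3, (63) p.272, (23)–(25) p.262; Balaban1987RG1, (1.6)–(1.9) p.261, (1.18)–(1.19) p.263, (1.21) p.264, (2.11)–(2.14) pp.267–268, (1.1)–(1.2) p.260, p.263 L5–13;
Balaban1985Variational, Thm 1 p.279, Prop. 9 p.309] -/
theorem lzdetResidueOnReg_of_carriers_classP5Nest {Mc : ℕ} (hMc : McGuard F Mc) (k : ℕ) {a₀ ε₂₉ α₀ α₁ c₀ γ₀ γ₁ δ₀ κt Bc R ε₀ ε₁ γ' : ℝ}
    (ha₀ : 0 < a₀) (hα₀ : 0 < α₀) (hα₁ : 0 < α₁) (hc₀ : 0 < c₀) (hγ' : 0 < γ') (hBc : 0 ≤ Bc) (hR : 0 < R) (hR₁ : 2 * γ' ≤ R)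
    (hδ : kappa₀ (4 * 2 ^ 4) (2 * 4) ≤ δ₀ / 2 - 1)
    (hRc : 2 * ((2 * c₀) * (4 * 2 ^ 4 * K₀ (4 * 2 ^ 4) (2 * 4)) * Real.exp δ₀) ≤ R)
    (hε₀ : 0 < ε₀) (hε₀c : ε₀ ≤ 1 / (53581824 * (F.L : ℝ) ^ 6)) (hε₀₁ : 2 * ε₀ ≤ ε₁)
    (hTokE : ∀ (n : ℕ) (V : GaugeField (F.P (recordK₀ F Mc k + n)) (k + 1) (SU 2)), PlaqSmall ε₁ V →
      UkExists F 2 (recordK₀ F Mc k + n) (k + 1) a₀ V ∧ UniqueUkOrbit F 2 (recordK₀ F Mc k + n) (k + 1) a₀ V)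
    (TC : (n : ℕ) → Sect2.CPair (F.P (recordK₀ F Mc k + n)) (MatA 2) → FluctIdx F k (recordK₀ F Mc k + n) → FluctIdx F k (recordK₀ F Mc k + n) → ℂ)
    (TY : (n : ℕ) → (recordDomSys F Mc k (recordK₀ F Mc k + n)).Dom → Sect2.CPair (F.P (recordK₀ F Mc k + n)) (MatA 2) →
        FluctIdx F k (recordK₀ F Mc k + n) → FluctIdx F k (recordK₀ F Mc k + n) → ℂ)
    (TZY : Finset (Fin 4 → ℤ) → IntBondCfg → ((Fin 4 → ℤ) × Fin 4) × Fin 3 → ((Fin 4 → ℤ) × Fin 4) × Fin 3 → ℂ)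
    (AdM : (n : ℕ) → (Site (F.P (recordK₀ F Mc k + n)) 0 → (MatA 2)ˣ) → Matrix (FluctIdx F k (recordK₀ F Mc k + n)) (FluctIdx F k (recordK₀ F Mc k + n)) ℂ)
    (AdZ : ((Fin 4 → ℤ) → (MatA 2)ˣ) → (Fin 4 → ℤ) × Fin 4 → Matrix (Fin 3) (Fin 3) ℂ)
    (hP : P0CarrierClauses F a₀ δ₀ c₀ γ₀ γ₁ Mc α₀ α₁ ε₂₉ k TC TY TZY AdM AdZ)
    (EG : ℝ → (n : ℕ) → (recordDomSys F Mc k (recordK₀ F Mc k + n)).Dom → Sect2.CPair (F.P (recordK₀ F Mc k + n)) (MatA 2) → ℂ)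
    (EGZ : ℝ → IntFormula) (hG : G3CPiecesAt F Mc k a₀ ε₂₉ α₀ α₁ κt Bc TC EG EGZ)
    (hg1pt : ∀ (n : ℕ) (x : ℝ), 0 ≤ x → ∀ φ : Sect2.CPair (F.P (recordK₀ F Mc k + n)) (MatA 2),
      ∑ X : (recordDomSys F Mc k (recordK₀ F Mc k + n)).Dom, EG x n X φ =
        (((x : ℂ) • (1 : Matrix (NonB0Idx F k (recordK₀ F Mc k + n)) (NonB0Idx F k (recordK₀ F Mc k + n)) ℂ) +
          Matrix.of (fun i j : NonB0Idx F k (recordK₀ F Mc k + n) => TC n φ i.1 j.1))⁻¹).trace)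
    (ΨP : IntLocalFormula (F.L ^ (k + 1) * Mc))
    (hΨP : ∀ (n : ℕ) (X : (recordDomSys F Mc k (recordK₀ F Mc k + n)).Dom), X ∉ recordWrapCtr F Mc k (recordK₀ F Mc k + n) →
      ∀ φ : Sect2.CPair (F.P (recordK₀ F Mc k + n)) (MatA 2),
        ΨP.Ψ.piece F Mc k (recordK₀ F Mc k + n) X φ =
          powMemberPiece (fun Y : (recordDomSys F Mc k (recordK₀ F Mc k + n)).Dom =>
              (Y.1 : Finset (TPt (F.P (recordK₀ F Mc k + n)).d (Sect2.domCount (F.P (recordK₀ F Mc k + n)) Mc (k + 1)))))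
            (fun Y => nonB0Block F k (recordK₀ F Mc k + n) (TY n Y φ)) R X.1)
    -- the three class rows at `ε₀`, DISPLAYED
    (hP2R : ∀ (n : ℕ) (B : recordW F a₀ ε₂₉ k (recordK₀ F Mc k + n)), InRegClass F Mc k ε₀ a₀ ε₂₉ n B →
      letI θ := thetaFill F a₀ ε₂₉
      ∀ i j : NonB0Idx F k (recordK₀ F Mc k + n),
        TC n (recordPairJ F θ k (recordK₀ F Mc k + n) B) i.1 j.1 =
          ((recordPreckLoc F k (recordK₀ F Mc k + n) a₀ (portVkAx F a₀ ε₂₉ k (recordK₀ F Mc k + n) B)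
            (hopLinGraph F k (recordK₀ F Mc k + n) (portVkAx F a₀ ε₂₉ k (recordK₀ F Mc k + n) B)) i j : ℝ) : ℂ))
    (hP5R : ∀ (n : ℕ) (B : recordW F a₀ ε₂₉ k (recordK₀ F Mc k + n)), InRegClass F Mc k ε₀ a₀ ε₂₉ n B →
      (recordPreckLoc F k (recordK₀ F Mc k + n) a₀ (portVkAx F a₀ ε₂₉ k (recordK₀ F Mc k + n) B)
          (hopLinGraph F k (recordK₀ F Mc k + n) (portVkAx F a₀ ε₂₉ k (recordK₀ F Mc k + n) B))).PosDef ∧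
      ∀ v : NonB0Idx F k (recordK₀ F Mc k + n) → ℝ,
          dotProduct v (Matrix.mulVec (recordPreckLoc F k (recordK₀ F Mc k + n) a₀ (portVkAx F a₀ ε₂₉ k (recordK₀ F Mc k + n) B)
              (hopLinGraph F k (recordK₀ F Mc k + n) (portVkAx F a₀ ε₂₉ k (recordK₀ F Mc k + n) B))) v) ≤
            γ' * dotProduct v v)
    (hNest : ∀ (n : ℕ) (B : recordW F a₀ ε₂₉ k (recordK₀ F Mc k + n)), InRegClass F Mc k ε₀ a₀ ε₂₉ n B → CutsInUc F Mc k α₀ α₁ a₀ ε₂₉ n B) :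
    ∃ (Ψ : IntLocalFormula (F.L ^ (k + 1) * Mc)) (Ew : TorusPieces F Mc k),
      Ψ.ResidueOnRegAtW F Mc k Ew a₀ ε₂₉ α₀ α₁ ε₀ (2 * (13 * 4 ^ 4 * (R * Bc + ((3 * 4 * (F.L * Mc) ^ 4 : ℕ) : ℝ)))) (min κt (δ₀ / 2) - 2)
        (phiLZdet F Mc a₀ ε₂₉ k) := by
  obtain ⟨hZsupp, hZdom, hZloc, hZcov, hZbr, hP2, hP3, hP4sum, hP4supp, hP4loc, hP4an, hP5, hP5c⟩ := hP
  obtain ⟨hg1, hg235, hg4, hg6, hgZ⟩ := hG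
  -- constants
  have hc₀' : (0 : ℝ) ≤ c₀ := hc₀.le
  have hKc : 0 ≤ 4 * 2 ^ 4 * K₀ (4 * 2 ^ 4) (2 * 4) := by have := B12TreeDecay.K₀_pos (4 * 2 ^ 4) (2 * 4); positivity
  have hRc₁ : 2 * (c₀ * (4 * 2 ^ 4 * K₀ (4 * 2 ^ 4) (2 * 4)) * Real.exp δ₀) ≤ R := by
    have : c₀ * (4 * 2 ^ 4 * K₀ (4 * 2 ^ 4) (2 * 4)) * Real.exp δ₀ ≤ (2 * c₀) * (4 * 2 ^ 4 * K₀ (4 * 2 ^ 4) (2 * 4)) * Real.exp δ₀ := by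
      nlinarith [mul_nonneg hKc (Real.exp_nonneg δ₀), hc₀']
    linarith
  have hK : ∀ n : ℕ, recordK₀ F Mc k ≤ recordK₀ F Mc k + n := fun n => Nat.le_add_right _ _
  have hdj : ∀ (n : ℕ) (Y : (recordDomSys F Mc k (recordK₀ F Mc k + n)).Dom), (recordDomSys F Mc k (recordK₀ F Mc k + n)).dj Y =
      torusTreeLen (Y.1 : Finset (TPt (F.P (recordK₀ F Mc k + n)).d (Sect2.domCount (F.P (recordK₀ F Mc k + n)) Mc (k + 1)))) := fun _ _ => rfl
  -- the cube map and the support of the pieces in cube form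
  have hsupp : ∀ (n : ℕ) Y φ (s s' : NonB0Idx F k (recordK₀ F Mc k + n)),
      (cubeOfSite F Mc k (recordK₀ F Mc k + n) (blockOf s.1.1.src) ∉ (Y.1 : Finset (TPt (F.P (recordK₀ F Mc k + n)).d (Sect2.domCount (F.P (recordK₀ F Mc k + n)) Mc (k + 1)))) ∨
        cubeOfSite F Mc k (recordK₀ F Mc k + n) (blockOf s'.1.1.src) ∉ (Y.1 : Finset (TPt (F.P (recordK₀ F Mc k + n)).d (Sect2.domCount (F.P (recordK₀ F Mc k + n)) Mc (k + 1))))) →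
        TY n Y φ s.1 s'.1 = 0 :=
    fun n Y φ s s' h => fluct_supp_of_cube hMc (hK n) (hP4supp n) Y φ s s' h
  have hV : ∀ (n : ℕ) q, (univ.filter fun s : NonB0Idx F k (recordK₀ F Mc k + n) => cubeOfSite F Mc k (recordK₀ F Mc k + n) (blockOf s.1.1.src) = q).card ≤ 3 * 4 * (F.L * Mc) ^ 4 :=
    fun n q => card_filter_cube_le hMc (hK n) q
  -- operator-norm decay of the non-b₀ blocks from (P4)'s Schur decay
  have hTYop : ∀ (n : ℕ) (Y : (recordDomSys F Mc k (recordK₀ F Mc k + n)).Dom) φ, encodeCfg F (recordK₀ F Mc k + n) φ ∈ recordUc F Mc k α₀ α₁ (recordK₀ F Mc k + n) Y →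
      ‖nonB0Block F k (recordK₀ F Mc k + n) (TY n Y φ)‖ ≤ c₀ * Real.exp (-(δ₀ * torusTreeLen (Y.1 : Finset (TPt (F.P (recordK₀ F Mc k + n)).d (Sect2.domCount (F.P (recordK₀ F Mc k + n)) Mc (k + 1)))))) := by
    intro n Y φ hφ
    obtain ⟨-, hrow, hcol⟩ := hP4an n Y φ hφ
    rw [← hdj]
    exact norm_nonB0Block_le_of_schur F k _ (TY n Y φ) (by positivity) hrow hcol
  -- the same at a pair that CUTS INTO the record space of `Y` (locality of the pieces)
  have hTYopCut : ∀ (n : ℕ) (B : recordW F a₀ ε₂₉ k (recordK₀ F Mc k + n)), CutsInUc F Mc k α₀ α₁ a₀ ε₂₉ n B →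
      ∀ Y : (recordDomSys F Mc k (recordK₀ F Mc k + n)).Dom,
        ‖nonB0Block F k (recordK₀ F Mc k + n) (TY n Y (recordPairJ F (thetaFill F a₀ ε₂₉) k (recordK₀ F Mc k + n) B))‖ ≤
          c₀ * Real.exp (-(δ₀ * torusTreeLen (Y.1 : Finset (TPt (F.P (recordK₀ F Mc k + n)).d (Sect2.domCount (F.P (recordK₀ F Mc k + n)) Mc (k + 1)))))) := by
    intro n B hB Y
    have hag : Sect2.agreeOnSet (Sect2.domSites (F.P (recordK₀ F Mc k + n)) Mc (k + 1) Y)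
        (recordPairJ F (thetaFill F a₀ ε₂₉) k (recordK₀ F Mc k + n) B) (pairCutTorusAt F a₀ ε₂₉ Mc k (recordK₀ F Mc k + n) Y B) :=
      agreeOnSet_pairCutTorusAt a₀ ε₂₉ Mc k (recordK₀ F Mc k + n) Y B
    rw [hP4loc n Y (recordPairJ F (thetaFill F a₀ ε₂₉) k (recordK₀ F Mc k + n) B) (pairCutTorusAt F a₀ ε₂₉ Mc k (recordK₀ F Mc k + n) Y B) hag]
    exact hTYop n Y _ (hB Y)
  -- x-continuity of the resolvent pieces at a pair that cuts into the record space of `X`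
  have hcontCut : ∀ (n : ℕ) (B : recordW F a₀ ε₂₉ k (recordK₀ F Mc k + n)), CutsInUc F Mc k α₀ α₁ a₀ ε₂₉ n B →
      ∀ X : (recordDomSys F Mc k (recordK₀ F Mc k + n)).Dom,
        ContinuousOn (fun x : ℝ => EG x n X (recordPairJ F (thetaFill F a₀ ε₂₉) k (recordK₀ F Mc k + n) B)) (Set.Icc 0 R) := by
    intro n B hB X
    obtain ⟨O, hO, hOsub, hx, hcont⟩ := hg235 n X
    have hag : Sect2.agreeOnSet (Sect2.domSites (F.P (recordK₀ F Mc k + n)) Mc (k + 1) X)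
        (recordPairJ F (thetaFill F a₀ ε₂₉) k (recordK₀ F Mc k + n) B) (pairCutTorusAt F a₀ ε₂₉ Mc k (recordK₀ F Mc k + n) X B) :=
      agreeOnSet_pairCutTorusAt a₀ ε₂₉ Mc k (recordK₀ F Mc k + n) X B
    have hfun : (fun x : ℝ => EG x n X (recordPairJ F (thetaFill F a₀ ε₂₉) k (recordK₀ F Mc k + n) B)) =
        fun x : ℝ => EG x n X (pairCutTorusAt F a₀ ε₂₉ Mc k (recordK₀ F Mc k + n) X B) :=
      funext fun x => hg4 x n X _ _ hag
    rw [hfun]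
    exact (hcont _ (hOsub (hB X))).mono Set.Icc_subset_Ici_self
  -- the unit pair lies in every record space
  have hunit : ∀ (n : ℕ) (X : (recordDomSys F Mc k (recordK₀ F Mc k + n)).Dom),
      encodeCfg F (recordK₀ F Mc k + n) (unitCPair F (recordK₀ F Mc k + n)) ∈ recordUc F Mc k α₀ α₁ (recordK₀ F Mc k + n) X := by
    intro n X
    have h := encodeCfg_unitPair_mem_recordUc F Mc k (recordK₀ F Mc k + n) X hα₀ hα₁
    rwa [embedPair_unitPair] at h
  -- §1: the integer formula
  set unitZ : IntBondCfg := fun _ => (1, 0) with hunitZ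
  set ΨG : IntFormula := fun Xh f => (1 / 2 : ℂ) * (∫ x in (0 : ℝ)..R, EGZ x Xh f) + ΨP.Ψ Xh f with hΨG
  have hΨGloc : IntFormula.IsLocal (F.L ^ (k + 1) * Mc) ΨG := isLocal_lzdetGFormula EGZ ΨP hR.le fun x hx => (hgZ x hx).1
  have hΨGinv : IntFormula.IsGaugeInv ΨG := isGaugeInv_lzdetGFormula EGZ ΨP hR.le fun x hx => (hgZ x hx).2.1
  let Ψ : IntLocalFormula (F.L ^ (k + 1) * Mc) := ⟨fun Xh f => ΨG Xh f - ΨG Xh unitZ, isLocal_subUnit _ ΨG hΨGloc, isGaugeInv_subUnit ΨG hΨGinv⟩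
  -- the unsubtracted torus piece IS `ΨG` read through the cover, off the wrap class
  have hGpiece : ∀ (n : ℕ) (X : (recordDomSys F Mc k (recordK₀ F Mc k + n)).Dom), X ∉ recordWrapCtr F Mc k (recordK₀ F Mc k + n) →
      ∀ ψ, ΨG (intCubes F Mc k (recordK₀ F Mc k + n) X) (pullPair F (recordK₀ F Mc k + n) ψ) = lzdetGPiece F Mc k (recordK₀ F Mc k + n) (TY n) (fun x => EG x n) R X ψ := by
    intro n X hX ψ
    have hint : (∫ x in (0 : ℝ)..R, EGZ x (intCubes F Mc k (recordK₀ F Mc k + n) X) (pullPair F (recordK₀ F Mc k + n) ψ)) = ∫ x in (0 : ℝ)..R, EG x n X ψ :=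
      intervalIntegral.integral_congr fun x hx => by
        rw [Set.uIcc_of_le hR.le] at hx
        exact (hgZ x hx.1).2.2 n X hX ψ
    show (1 / 2 : ℂ) * (∫ x in (0 : ℝ)..R, EGZ x _ _) + ΨP.Ψ _ _ = _
    rw [hint]
    unfold lzdetGPiece
    congr 1
    exact hΨP n X hX ψ
  refine ⟨Ψ, lzdetTorusPieces F Mc k TY EG R, residueOnRegAtW_of_piecesJ F Mc k a₀ ε₂₉ α₀ α₁ ε₀ _ _ Ψ _ _ ?_ ?_ ?_ ?_ ?_ ?_⟩
  · -- off-wrap pieces = pull-back pieces of Ψ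
    intro n X hX φ
    show lzdetPiece F Mc k (recordK₀ F Mc k + n) (TY n) (fun x => EG x n) R X φ =
      ΨG (intCubes F Mc k (recordK₀ F Mc k + n) X) (pullPair F (recordK₀ F Mc k + n) φ) - ΨG (intCubes F Mc k (recordK₀ F Mc k + n) X) unitZ
    have hu : unitZ = pullPair F (recordK₀ F Mc k + n) (unitCPair F (recordK₀ F Mc k + n)) := rfl
    rw [hu, hGpiece n X hX, hGpiece n X hX]
    rfl
  · -- row (a)
    intro n X φ hφ
    obtain ⟨O, hO, hOsub, hx, hcont⟩ := hg235 n X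
    exact analyticAt_lzdetPiece F Mc k (recordK₀ F Mc k + n) (TY n) (fun x => EG x n) (fun s => cubeOfSite F Mc k (recordK₀ F Mc k + n) (blockOf s.1.1.src))
      hR hc₀ hδ hRc (hsupp n) X hO (fun ψ hψ => hOsub hψ) (fun x hx' => (hx x hx').1) (fun x hx' ψ hψ => (hx x hx').2 ψ hψ) hcont
      (fun Y ψ hψ => (hP4an n Y ψ hψ).1) (fun Y ψ hψ => (hP4an n Y ψ hψ).2.1) (fun Y ψ hψ => (hP4an n Y ψ hψ).2.2) φ hφ
  · -- row (b)
    intro n X φ hφ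
    obtain ⟨O, hO, hOsub, hx, hcont⟩ := hg235 n X
    have hmem : ∀ ψ ∈ ({φ, unitCPair F (recordK₀ F Mc k + n)} : Set (Sect2.CPair (F.P (recordK₀ F Mc k + n)) (MatA 2))),
        encodeCfg F (recordK₀ F Mc k + n) ψ ∈ recordUc F Mc k α₀ α₁ (recordK₀ F Mc k + n) X := by
      intro ψ hψ
      rcases hψ with rfl | hψ
      · exact hφ
      · rw [Set.mem_singleton_iff] at hψ; rw [hψ]; exact hunit n X
    have h := norm_lzdetPiece_le F Mc k (recordK₀ F Mc k + n) (TY n) (fun x => EG x n) (fun s => cubeOfSite F Mc k (recordK₀ F Mc k + n) (blockOf s.1.1.src))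
      hR hBc hc₀' hδ hRc₁ (hsupp n) (hV n) X φ
      (fun ψ hψ x hx' => (hx x hx'.1).2 ψ (hOsub (hmem ψ hψ)))
      (fun ψ hψ Y hY => hTYop n Y ψ (recordUc_anti F Mc k α₀ α₁ _ hY (hmem ψ hψ)))
    rw [neg_mul]
    exact h
  · -- row (c)
    intro n X φ ψ hag
    exact lzdetPiece_congr_of_agreeOnSet F Mc k (recordK₀ F Mc k + n) (TY n) (fun x => EG x n) R X (hP4loc n) (fun x φ' ψ' h => hg4 x n X φ' ψ' h) hag
  · -- row (d)
    intro n X u φ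
    obtain ⟨hU, hdiag, hcov⟩ := hP3 n u.1
    exact lzdetPiece_cAct F Mc k (recordK₀ F Mc k + n) (TY n) (fun x => EG x n) R X u.1 (AdM n u.1) hU hdiag hcov (fun x φ' => hg6 x n X u.1 φ') φ
  · -- the (63) identity AT EVERY CLASS POINT
    intro n B hB
    letI θ := thetaFill F a₀ ε₂₉; letI := θ.instVβ₁; letI := θ.instVβ₂; letI := θ.instιβ
    have h0 : InRegClass F Mc k ε₀ a₀ ε₂₉ n (0 : recordW F a₀ ε₂₉ k (recordK₀ F Mc k + n)) := inRegClass_zero F Mc k n ε₂₉ hε₀ ha₀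
    have hor : ∀ B' : recordW F a₀ ε₂₉ k (recordK₀ F Mc k + n), (B' = B ∨ B' = 0) → InRegClass F Mc k ε₀ a₀ ε₂₉ n B' := by
      rintro B' (rfl | rfl)
      · exact hB
      · exact h0
    exact phiLZdet_eq_sum_lzdetPiece_at F Mc a₀ ε₂₉ k n B (TC n) (TY n) (fun x => EG x n)
      (fun s => cubeOfSite F Mc k (recordK₀ F Mc k + n) (blockOf s.1.1.src)) hγ' hc₀' hδ hR₁ hRc₁
      (recordB0BlockInvertible_portVkAx_of_inRegClass F a₀ ε₂₉ Mc k n hε₀ hε₀c hε₀₁ (hTokE n) hB)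
      (fun B' hB' => hP2R n B' (hor B' hB'))
      (fun B' hB' => hP5R n B' (hor B' hB'))
      (hP4sum n) (hsupp n)
      (fun B' hB' => hTYopCut n B' (hNest n B' (hor B' hB')))
      (fun φ x hx => by rw [hg1pt n x hx φ]; rfl)
      (fun B' hB' => hcontCut n B' (hNest n B' (hor B' hB')))

end Summit.QuantumFields.YangMills.Theorems.BalabanUVNodesPortS1

end
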